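import Summits.QuantumFields.YangMills.Theorems.BalabanUVNodesN15KingModelCombesThomasEngine
import Summits.QuantumFields.YangMills.Theorems.BalabanUVNodesN15KingModelCovariantBlockOperator
import Literature.MathematicalPhysics.QuantumFieldTheory.King1986.UniformDecay
import HarnessLib

/-!
# BalabanUVNodes ∕ N15 — THE KING-MODEL RUNG (PART Ϧ-b): THE TWO CONJUGATION DEFECTS OF THE FULL FINE OPERATOR `A₀(U) = −cΔ_U + m² + aQ(U)^*Q(U)` — the fine Laplacian loses
# `2(d+1)c(cosh δ − 1)` for a weight `δ`-Lipschitz across bonds, the COVARIANT BLOCK TERM loses `a(cosh ϑ − 1)` for a weight oscillating by `ϑ` on blocks (cosh symmetrisation on the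
# transported fibres — second order, as in Dimock's (city1)); hence «`κ`-coercive `A₀(U)` ⟹ `(κ − ρ)`-coercive conjugated `A₀(U)`» at EVERY unitary link field, and with the tree's
# Combes–Thomas weight `ctW` (`κ_w∕L`-Lipschitz, block oscillation `κ_w`)
# (Track A, DAG node N15 = NE2; FAN-OUT v1.1 §N15 s3 «KING-MODEL RUNG … + what the curved case adds»; count-neutral)

HONEST FRAMING.  Count-neutral (cell `pub-ymgap`, seat `pub-ymgap-dag-n15-e` g50; `--supports stmt-QuantumFields-27247 --as helper` = K3ᴬ, KEY MAP v3).  King's one-level comparison model on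
ONE finite torus `Tor (fine L M)`; Bałaban's one-level covariant block mean `Q(U)` along a tree contour system (PART Ϥ-c) at a UNITARY link field (any fibre `𝕜ⁿ`).  The fine-Laplacian defect
is PART Ϳ-g's `re_conjForm_ge` re-derived as a DEFECT inequality (Ϳ-g states it only through an `∀v`-coercivity hypothesis on `−cΔ_U+m²` alone, which the full operator does not supply); the
block defect is NEW (the tree's real `King1986.Torus.blockProj_coshRow_le` is the `U ≡ 1`, scalar, Schur-row version).  NOT Bałaban's multi-level `Q_k(U)`; NOT (3.42); NOT a node discharge
(N15 of record untouched); nothing continuum ∕ ℝ⁴ ∕ OS ∕ Clay.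

THE RESULTS (unitary `U`; `N(ω) := Σ_x‖ω_x‖²`; `T_φ = e^{φ}Te^{−φ}` = PART Ϧ-a `wtConj`):
* §1 (any torus `K`) `fib_expWt`, ★ `re_conjForm_covLapF_sub_ge` — `Re⟨ω,(−cΔ_U+m²)ω⟩ − 2(d+1)c(cosh δ − 1)·N(ω) ≤ Re⟨ω,(−cΔ_U+m²)_φ ω⟩` for `|φ(x) − φ(x+e_μ)| ≤ δ` on every bond (`c ≥ 0`, any
  `m²`) — the antisymmetric first-order part of the conjugation error cancels in the real part (Ϳ-g `re_weighted_bond_pair`).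
* §2 (abstract, any inner-product space) ★★ `re_inner_sum_expWt_ge` — for vectors `β_j` and real `s_j` with `|s_j − s_{j′}| ≤ ϑ`:
  `‖Σ_jβ_j‖² − (cosh ϑ − 1)(Σ_j‖β_j‖)² ≤ Re⟪Σ_j e^{s_j}β_j, Σ_j e^{−s_j}β_j⟫` (cosh symmetrisation of `Σ_{j,j′}e^{s_j−s_{j′}}Re⟪β_j,β_{j′}⟫`).
* §3 (fine torus `Tor (fine L M)`, tree contour system `T`) `star_dotProduct_gram_mulVec` (`⟨u,QᴴQw⟩ = Σ_y⟪(Qu)_y,(Qw)_y⟫`), `fib_covQ_mulVec_expWt` (`(Q(U)e^{±φ}ω)_y = L^{−(d+1)}Σ_je^{±φ(x_j)}U(Γ_j)ω_{x_j}`),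
  ★★★ **`re_conjForm_gram_sub_ge`** — THE BLOCK DEFECT: `Re⟨ω,Q(U)ᴴQ(U)ω⟩ − (cosh ϑ − 1)L^{−(d+1)}·N(ω) ≤ Re⟨ω,(Q(U)ᴴQ(U))_φ ω⟩` whenever `|φ(x) − φ(x′)| ≤ ϑ` for `x, x′` in one block.
* §4 ★★★ **`re_conjForm_fullOpU_sub_ge`** (`Re⟨ω,A₀(U)ω⟩ − (2(d+1)c(cosh δ−1) + a(cosh ϑ−1))N(ω) ≤ Re⟨ω,A₀(U)_φ ω⟩`, `a, c ≥ 0`), ★★★ **`re_conjForm_fullOpU_ge`** (`κ`-coercive `A₀(U)` ⟹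
  `(κ − 2(d+1)c(cosh δ−1) − a(cosh ϑ−1))`-coercive `A₀(U)_φ`), and with the tree's weight `King1986.Torus.ctW L M κ_w x₀ = (κ_w∕L)·tdist(·,x₀)` (bond oscillation `κ_w∕L`, block oscillation
  `κ_w`): ★★★ **`re_conjForm_fullOpU_ctW_ge`** (`(κ − 2(d+1)c(cosh(κ_w∕L)−1) − a(cosh κ_w−1))·N(ω) ≤ Re⟨ω, A₀(U)_{ctW} ω⟩`, every `κ_w ≥ 0`, every centre `x₀`).
PRIOR TREE ART (by name, not restated): Ϧ-a (`wtConj`, `star_dotProduct_wtConj_mulVec`, `wtConj_add`, `wtConj_smul`), Ϳ-g (`expWt`, `star_dotProduct_covLapF_mulVec`, `re_weighted_bond_pair`,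
`abs_re_star_dotProduct_unitary_mulVec_le`, `star_wt_dotProduct_mulVec_wt`), Ͱ-b∕Ͱ-f (`fib`, `sum_norm_fib_sq`, `sum_norm_fib_add_unitVec`), Ϥ-b∕Ϥ-c (`BlockTree`, `covQ`, `covQ_mulVec_apply`,
`blockTransport`, `norm_blockTransport`, `sum_norm_blockTransport_sq`), Ϥ-d (`fullOpU`), `King1986.Torus` (`site`, `blockOf_site`, `blockEquiv`, `ctW`, `abs_ctW_bond_le`, `abs_ctW_block_le`),
Mathlib (`sq_sum_le_card_mul_sum_sq`, `inner_smul_left∕right`, `sum_inner`, `inner_sum`, `Real.cosh_eq`, `Real.cosh_le_cosh`).  Dedup (rg at filing): basename 0 files; needles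
`re_conjForm_covLapF_sub_ge|re_inner_sum_expWt_ge|re_conjForm_gram_sub_ge|re_conjForm_fullOpU` 0 tree files.  Locators: [Dimock2013] App. D proof of Lemma 30 (city1) «|⟨f,[𝒟_q − 𝒟_0]f⟩| ≤
c₁|q|⟨f,(−Δ+I)f⟩» (the defect, there for Neumann cubes at `A = 0`); [King1986] (2.13) p.653, (4.5) p.670 (the block term `aQ^*Q`); [Balaban1985BackgroundPropagators] (3.19) p.393, (3.24) p.394
(the covariant block mean and `Δ_a(U)`).  0 `sorry`, 0 `def`.
-/

noncomputable section
open scoped BigOperators ComplexConjugate ComplexOrder InnerProductSpace Matrix.Norms.L2Operator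
open Finset Matrix WithLp

namespace Summit.QuantumFields.YangMills.BalabanUVNodes.N15KingModelRung.CombesThomas

open Literature.MathematicalPhysics.QuantumFieldTheory.Balaban1983to89.B5Prop11Plancherel (Tor fine unitVec)
open Literature.MathematicalPhysics.QuantumFieldTheory.King1986.Torus (site blockOf blockOf_site blockEquiv blockEquiv_apply ctW abs_ctW_bond_le abs_ctW_block_le)
open Summit.QuantumFields.YangMills.BalabanUVNodes.N15KingModelRung.Covariant (covLapF fib fib_apply norm_apply_le_norm_fib sum_norm_fib_sq sum_norm_fib_add_unitVec)
open Summit.QuantumFields.YangMills.BalabanUVNodes.N15KingModelRung.Curvature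
  (expWt wt_neg_wt norm_wt_apply star_dotProduct_covLapF_mulVec re_weighted_bond_pair abs_re_star_dotProduct_unitary_mulVec_le star_wt_dotProduct_mulVec_wt)
open Summit.QuantumFields.YangMills.BalabanUVNodes.N15KingModelRung.CovariantBlock (BlockTree covQ covQ_mulVec_apply blockTransport norm_blockTransport sum_norm_blockTransport_sq fullOpU treeHol)

variable {d : ℕ}
variable {𝕜 : Type*} [RCLike 𝕜] {n : Type*} [Fintype n] [DecidableEq n]

/-! ## §1 The fine-Laplacian defect (any torus) -/

section Laplacian

variable (K : Fin (d + 1) → ℕ) [hK : ∀ μ, NeZero (K μ)]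

omit [Fintype n] [DecidableEq n] hK in
/-- Fibres of a weighted field: `(e^{φ}v)_x = e^{φ(x)}·v_x`. [folklore] -/
theorem fib_expWt (φ : Tor K → ℝ) (v : Tor K × n → 𝕜) (x : Tor K) : fib K (expWt K φ v) x = ((Real.exp (φ x) : ℝ) : 𝕜) • fib K v x := by
  ext i; rw [fib_apply, expWt, PiLp.smul_apply, fib_apply, smul_eq_mul]

/-- ★ **THE FINE-LAPLACIAN DEFECT**: for unitary `U`, `c ≥ 0`, any `m²`, and a weight with `|φ(x) − φ(x+e_μ)| ≤ δ` on every bond: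
`Re⟨ω,(−cΔ_U+m²)ω⟩ − 2(d+1)c(cosh δ − 1)·Σ_x‖ω_x‖² ≤ Re⟨ω,(−cΔ_U+m²)_φ ω⟩` (each bond contributes `2cosh(Δφ)Re z_b` instead of `2Re z_b`, `|Re z_b| ≤ ‖ω_x‖‖ω_{x+e_μ}‖`).
[cite: Dimock2013, App. D, proof of Lemma 30 (city1); King1986, (4.4) p.670; Balaban1985BackgroundPropagators, (3.23) p.394] -/
theorem re_conjForm_covLapF_sub_ge {c : ℝ} (hc : 0 ≤ c) (m2 : ℝ) {U : Tor K × Fin (d + 1) → Matrix n n 𝕜} (hU : ∀ b, U b ∈ Matrix.unitaryGroup n 𝕜) {φ : Tor K → ℝ} {δ : ℝ}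
    (hφ : ∀ x μ, |φ x - φ (x + unitVec K μ)| ≤ δ) (ω : Tor K × n → 𝕜) :
    RCLike.re (star ω ⬝ᵥ (covLapF K c m2 U *ᵥ ω)) - 2 * ((d : ℝ) + 1) * c * (Real.cosh δ - 1) * ∑ x, ‖fib K ω x‖ ^ 2
      ≤ RCLike.re (star ω ⬝ᵥ (wtConj K φ (covLapF K c m2 U) *ᵥ ω)) := by
  rw [star_dotProduct_wtConj_mulVec]
  -- the two expansions
  have hE := star_dotProduct_covLapF_mulVec K c m2 U (expWt K φ ω) (expWt K (fun x => -φ x) ω)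
  have h0 := star_dotProduct_covLapF_mulVec K c m2 U ω ω
  -- diagonal terms agree
  have hdiag : ∀ x, (star (fun i => expWt K φ ω (x, i)) ⬝ᵥ fun i => expWt K (fun x => -φ x) ω (x, i)) = star (fun i => ω (x, i)) ⬝ᵥ fun i => ω (x, i) := fun x => by
    have h := star_wt_dotProduct_mulVec_wt (𝕜 := 𝕜) (φ x) (-φ x) (fun i => ω (x, i)) (fun i => ω (x, i)) 1
    simp only [Matrix.one_mulVec, add_neg_cancel, Real.exp_zero, RCLike.ofReal_one, one_mul] at h
    exact h
  have hbond : ∀ x μ, RCLike.re (star (fun i => expWt K φ ω (x, i)) ⬝ᵥ (U (x, μ) *ᵥ fun j => expWt K (fun x => -φ x) ω (x + unitVec K μ, j))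
        + star (fun i => expWt K φ ω (x + unitVec K μ, i)) ⬝ᵥ ((U (x, μ))ᴴ *ᵥ fun j => expWt K (fun x => -φ x) ω (x, j)))
      = 2 * Real.cosh (φ x - φ (x + unitVec K μ)) * RCLike.re (star (fun i => ω (x, i)) ⬝ᵥ (U (x, μ) *ᵥ fun j => ω (x + unitVec K μ, j))) := fun x μ =>
    re_weighted_bond_pair (φ x) (φ (x + unitVec K μ)) (fun i => ω (x, i)) (fun j => ω (x + unitVec K μ, j)) (U (x, μ))
  have hbond0 : ∀ x μ, RCLike.re (star (fun i => ω (x, i)) ⬝ᵥ (U (x, μ) *ᵥ fun j => ω (x + unitVec K μ, j))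
        + star (fun i => ω (x + unitVec K μ, i)) ⬝ᵥ ((U (x, μ))ᴴ *ᵥ fun j => ω (x, j)))
      = 2 * RCLike.re (star (fun i => ω (x, i)) ⬝ᵥ (U (x, μ) *ᵥ fun j => ω (x + unitVec K μ, j))) := fun x μ => by
    have h := re_weighted_bond_pair (𝕜 := 𝕜) 0 0 (fun i => ω (x, i)) (fun j => ω (x + unitVec K μ, j)) (U (x, μ))
    simp only [neg_zero, Real.exp_zero, RCLike.ofReal_one, one_mul, sub_self, Real.cosh_zero, mul_one] at h
    exact h
  set z : Tor K → Fin (d + 1) → ℝ := fun x μ => RCLike.re (star (fun i => ω (x, i)) ⬝ᵥ (U (x, μ) *ᵥ fun j => ω (x + unitVec K μ, j))) with hz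
  set N : ℝ := ∑ x, ‖fib K ω x‖ ^ 2 with hN
  have hdiagRe : RCLike.re (∑ x, (star (fun i => ω (x, i)) ⬝ᵥ fun i => ω (x, i))) = N := by
    rw [map_sum, hN, sum_norm_fib_sq]
    rw [EuclideanSpace.norm_eq, Real.sq_sqrt (Finset.sum_nonneg fun _ _ => sq_nonneg _), Fintype.sum_prod_type]
    refine Finset.sum_congr rfl fun x _ => ?_
    simp only [dotProduct, Pi.star_apply, map_sum, RCLike.star_def]
    refine Finset.sum_congr rfl fun i _ => ?_
    rw [RCLike.conj_mul, ← RCLike.ofReal_pow, RCLike.ofReal_re]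
  have hReE : RCLike.re (star (expWt K φ ω) ⬝ᵥ (covLapF K c m2 U *ᵥ expWt K (fun x => -φ x) ω))
      = (m2 + 2 * ((d : ℝ) + 1) * c) * N - c * ∑ x, ∑ μ, 2 * Real.cosh (φ x - φ (x + unitVec K μ)) * z x μ := by
    rw [hE, map_sub, RCLike.re_ofReal_mul, RCLike.re_ofReal_mul, Finset.sum_congr rfl fun x _ => hdiag x, hdiagRe, map_sum]
    congr 2
    refine Finset.sum_congr rfl fun x _ => ?_
    rw [map_sum]
    exact Finset.sum_congr rfl fun μ _ => hbond x μ
  have hRe0 : RCLike.re (star ω ⬝ᵥ (covLapF K c m2 U *ᵥ ω)) = (m2 + 2 * ((d : ℝ) + 1) * c) * N - c * ∑ x, ∑ μ, 2 * z x μ := by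
    rw [h0, map_sub, RCLike.re_ofReal_mul, RCLike.re_ofReal_mul, hdiagRe, map_sum]
    congr 2
    refine Finset.sum_congr rfl fun x _ => ?_
    rw [map_sum]
    exact Finset.sum_congr rfl fun μ _ => hbond0 x μ
  -- the defect
  have hzle : ∀ x μ, |z x μ| ≤ ‖fib K ω x‖ * ‖fib K ω (x + unitVec K μ)‖ := fun x μ => abs_re_star_dotProduct_unitary_mulVec_le (hU (x, μ)) _ _
  have hcosh : ∀ x μ, Real.cosh (φ x - φ (x + unitVec K μ)) - 1 ≤ Real.cosh δ - 1 := fun x μ => by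
    have := Real.cosh_le_cosh.mpr ((hφ x μ).trans (le_abs_self δ))
    linarith
  have hcosh0 : ∀ x μ, 0 ≤ Real.cosh (φ x - φ (x + unitVec K μ)) - 1 := fun x μ => by linarith [Real.one_le_cosh (φ x - φ (x + unitVec K μ))]
  have hdef : ∑ x, ∑ μ, 2 * Real.cosh (φ x - φ (x + unitVec K μ)) * z x μ - ∑ x, ∑ μ, 2 * z x μ ≤ 2 * ((d : ℝ) + 1) * (Real.cosh δ - 1) * N := by
    rw [← Finset.sum_sub_distrib]
    simp only [← Finset.sum_sub_distrib]
    calc ∑ x, ∑ μ, (2 * Real.cosh (φ x - φ (x + unitVec K μ)) * z x μ - 2 * z x μ)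
        ≤ ∑ x, ∑ μ, (Real.cosh δ - 1) * (‖fib K ω x‖ ^ 2 + ‖fib K ω (x + unitVec K μ)‖ ^ 2) := by
          refine Finset.sum_le_sum fun x _ => Finset.sum_le_sum fun μ _ => ?_
          have h1 : (2 * Real.cosh (φ x - φ (x + unitVec K μ)) * z x μ - 2 * z x μ) = 2 * (Real.cosh (φ x - φ (x + unitVec K μ)) - 1) * z x μ := by ring
          rw [h1]
          have h2 : 2 * (Real.cosh (φ x - φ (x + unitVec K μ)) - 1) * z x μ ≤ 2 * (Real.cosh δ - 1) * |z x μ| := by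
            calc 2 * (Real.cosh (φ x - φ (x + unitVec K μ)) - 1) * z x μ ≤ 2 * (Real.cosh (φ x - φ (x + unitVec K μ)) - 1) * |z x μ| :=
                  mul_le_mul_of_nonneg_left (le_abs_self _) (by linarith [hcosh0 x μ])
              _ ≤ 2 * (Real.cosh δ - 1) * |z x μ| := mul_le_mul_of_nonneg_right (by linarith [hcosh x μ]) (abs_nonneg _)
          have h3 : 2 * |z x μ| ≤ ‖fib K ω x‖ ^ 2 + ‖fib K ω (x + unitVec K μ)‖ ^ 2 := by
            nlinarith [hzle x μ, sq_nonneg (‖fib K ω x‖ - ‖fib K ω (x + unitVec K μ)‖), abs_nonneg (z x μ)]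
          have hC0 : 0 ≤ Real.cosh δ - 1 := by linarith [Real.one_le_cosh δ]
          nlinarith
      _ = 2 * ((d : ℝ) + 1) * (Real.cosh δ - 1) * N := by
          have hsw : ∑ x : Tor K, ∑ μ : Fin (d + 1), ‖fib K ω (x + unitVec K μ)‖ ^ 2 = ((d : ℝ) + 1) * N := by
            rw [Finset.sum_comm]
            simp only [sum_norm_fib_add_unitVec]
            rw [Finset.sum_const, Finset.card_univ, Fintype.card_fin, nsmul_eq_mul, hN]
            push_cast; ring
          have hsx : ∑ x : Tor K, ∑ _μ : Fin (d + 1), ‖fib K ω x‖ ^ 2 = ((d : ℝ) + 1) * N := by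
            simp only [Finset.sum_const, Finset.card_univ, Fintype.card_fin, nsmul_eq_mul, hN, Finset.mul_sum]
            push_cast; ring
          simp only [← Finset.mul_sum, Finset.sum_add_distrib]
          rw [hsw, hsx]; ring
  rw [hRe0, hReE]
  nlinarith [hdef, hc]

end Laplacian

/-! ## §2 The cosh symmetrisation for a family of vectors -/

section Abstract

variable {E : Type*} [NormedAddCommGroup E] [InnerProductSpace 𝕜 E]

omit [Fintype n] [DecidableEq n] in
/-- ★★ **COSH SYMMETRISATION**: for vectors `β_j` of an inner-product space and real weights with `|s_j − s_{j′}| ≤ ϑ` for all `j, j′`: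
`‖Σ_jβ_j‖² − (cosh ϑ − 1)·(Σ_j‖β_j‖)² ≤ Re⟪Σ_j e^{s_j}β_j, Σ_j e^{−s_j}β_j⟫` — `Re` of the cross Gram sum is `Σ_{j,j′}cosh(s_j − s_{j′})Re⟪β_j,β_{j′}⟫`. [cite: Dimock2013, App. D, proof of Lemma 30 (city1)] -/
theorem re_inner_sum_expWt_ge {J : Type*} [Fintype J] (β : J → E) (s : J → ℝ) {ϑ : ℝ} (hs : ∀ j j', |s j - s j'| ≤ ϑ) :
    ‖∑ j, β j‖ ^ 2 - (Real.cosh ϑ - 1) * (∑ j, ‖β j‖) ^ 2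
      ≤ RCLike.re ⟪∑ j, ((Real.exp (s j) : ℝ) : 𝕜) • β j, ∑ j, ((Real.exp (-(s j)) : ℝ) : 𝕜) • β j⟫_𝕜 := by
  set R : J → J → ℝ := fun j j' => RCLike.re ⟪β j, β j'⟫_𝕜 with hR
  have hRsymm : ∀ j j', R j' j = R j j' := fun j j' => by
    simp only [hR]; rw [← inner_conj_symm, RCLike.conj_re]
  have hRle : ∀ j j', |R j j'| ≤ ‖β j‖ * ‖β j'‖ := fun j j' => (RCLike.abs_re_le_norm _).trans (norm_inner_le_norm _ _)
  -- the weighted Gram sum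
  have hW : RCLike.re ⟪∑ j, ((Real.exp (s j) : ℝ) : 𝕜) • β j, ∑ j, ((Real.exp (-(s j)) : ℝ) : 𝕜) • β j⟫_𝕜 = ∑ j, ∑ j', Real.exp (s j - s j') * R j j' := by
    rw [sum_inner, map_sum]
    refine Finset.sum_congr rfl fun j _ => ?_
    rw [inner_sum, map_sum]
    refine Finset.sum_congr rfl fun j' _ => ?_
    rw [inner_smul_left, inner_smul_right, RCLike.conj_ofReal, ← mul_assoc, ← RCLike.ofReal_mul, ← Real.exp_add, RCLike.re_ofReal_mul, ← sub_eq_add_neg]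
  -- the plain Gram sum
  have hP : ‖∑ j, β j‖ ^ 2 = ∑ j, ∑ j', R j j' := by
    rw [@norm_sq_eq_re_inner 𝕜, sum_inner, map_sum]
    refine Finset.sum_congr rfl fun j _ => ?_
    rw [inner_sum, map_sum]
  -- symmetrise the weighted sum
  have hsymm : ∑ j, ∑ j', Real.exp (s j - s j') * R j j' = ∑ j, ∑ j', Real.cosh (s j - s j') * R j j' := by
    have h2 : ∑ j, ∑ j', Real.exp (s j - s j') * R j j' = ∑ j, ∑ j', Real.exp (s j' - s j) * R j j' := by
      rw [Finset.sum_comm]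
      exact Finset.sum_congr rfl fun j _ => Finset.sum_congr rfl fun j' _ => by rw [hRsymm j j']
    calc ∑ j, ∑ j', Real.exp (s j - s j') * R j j'
        = (1 / 2) * (∑ j, ∑ j', Real.exp (s j - s j') * R j j' + ∑ j, ∑ j', Real.exp (s j' - s j) * R j j') := by rw [← h2]; ring
      _ = ∑ j, ∑ j', Real.cosh (s j - s j') * R j j' := by
          rw [← Finset.sum_add_distrib, Finset.mul_sum]
          refine Finset.sum_congr rfl fun j _ => ?_
          rw [← Finset.sum_add_distrib, Finset.mul_sum]
          refine Finset.sum_congr rfl fun j' _ => ?_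
          rw [Real.cosh_eq, show s j' - s j = -(s j - s j') by ring]
          ring
  rw [hW, hsymm, hP]
  -- the defect per pair
  have hC0 : 0 ≤ Real.cosh ϑ - 1 := by linarith [Real.one_le_cosh ϑ]
  have hpair : ∀ j j', R j j' - (Real.cosh ϑ - 1) * (‖β j‖ * ‖β j'‖) ≤ Real.cosh (s j - s j') * R j j' := fun j j' => by
    have h1 : Real.cosh (s j - s j') - 1 ≤ Real.cosh ϑ - 1 := by
      have := Real.cosh_le_cosh.mpr ((hs j j').trans (le_abs_self ϑ)); linarith
    have h2 : 0 ≤ Real.cosh (s j - s j') - 1 := by linarith [Real.one_le_cosh (s j - s j')]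
    have h3 : (Real.cosh (s j - s j') - 1) * |R j j'| ≤ (Real.cosh ϑ - 1) * (‖β j‖ * ‖β j'‖) :=
      mul_le_mul h1 (hRle j j') (abs_nonneg _) hC0
    have h4 : -((Real.cosh (s j - s j') - 1) * |R j j'|) ≤ (Real.cosh (s j - s j') - 1) * R j j' := by
      rw [← mul_neg]; exact mul_le_mul_of_nonneg_left (neg_abs_le _) h2
    nlinarith
  have hsq : (∑ j, ‖β j‖) ^ 2 = ∑ j, ∑ j', ‖β j‖ * ‖β j'‖ := by rw [sq, Finset.sum_mul_sum]
  rw [hsq, Finset.mul_sum, ← Finset.sum_sub_distrib]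
  refine Finset.sum_le_sum fun j _ => ?_
  rw [Finset.mul_sum, ← Finset.sum_sub_distrib]
  exact Finset.sum_le_sum fun j' _ => hpair j j'

end Abstract

/-! ## §3 The block defect: the covariant Gram operator `Q(U)ᴴQ(U)` under a weight oscillating by `ϑ` on blocks -/

section Block

variable {L : ℕ} [NeZero L] (T : BlockTree d L) (M : Fin (d + 1) → ℕ) [hM : ∀ μ, NeZero (M μ)]

omit [Fintype n] [DecidableEq n] in
/-- Real scalars in both slots: `Re⟪rA, rB⟫ = r²Re⟪A,B⟫`. [folklore] -/
theorem re_inner_smul_ofReal {E : Type*} [NormedAddCommGroup E] [InnerProductSpace 𝕜 E] (r : ℝ) (A B : E) :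
    RCLike.re ⟪((r : ℝ) : 𝕜) • A, ((r : ℝ) : 𝕜) • B⟫_𝕜 = r ^ 2 * RCLike.re ⟪A, B⟫_𝕜 := by
  rw [inner_smul_left, inner_smul_right, RCLike.conj_ofReal, ← mul_assoc, ← RCLike.ofReal_mul, RCLike.re_ofReal_mul, sq]

omit [DecidableEq n] in
/-- `⟨u, QᴴQ w⟩ = Σ_y⟪(Qu)_y, (Qw)_y⟫` for any matrix `Q` into the block fields. [folklore] -/
theorem star_dotProduct_gram_mulVec (Q : Matrix (Tor M × n) (Tor (fine L M) × n) 𝕜) (u w : Tor (fine L M) × n → 𝕜) :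
    star u ⬝ᵥ ((Qᴴ * Q) *ᵥ w) = ∑ y, ⟪fib M (Q *ᵥ u) y, fib M (Q *ᵥ w) y⟫_𝕜 := by
  rw [← mulVec_mulVec, dotProduct_mulVec, ← star_mulVec]
  have h : star (Q *ᵥ u) ⬝ᵥ (Q *ᵥ w) = ∑ p, star ((Q *ᵥ u) p) * (Q *ᵥ w) p := rfl
  rw [h, Fintype.sum_prod_type]
  refine Finset.sum_congr rfl fun y _ => ?_
  unfold fib
  rw [EuclideanSpace.inner_toLp_toLp, dotProduct_comm]
  rfl

/-- `(Q(U)(e^{ψ}ω))_y = L^{−(d+1)}·Σ_j e^{ψ(x_j)}·U(Γ_j)ω_{x_j}` as vectors of `𝕜ⁿ`. [cite: Balaban1985BackgroundPropagators, (3.19) p.393] -/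
theorem fib_covQ_mulVec_expWt (U : Tor (fine L M) × Fin (d + 1) → Matrix n n 𝕜) (ψ : Tor (fine L M) → ℝ) (ω : Tor (fine L M) × n → 𝕜) (y : Tor M) :
    fib M (covQ T M U *ᵥ expWt (fine L M) ψ ω) y
      = (((((L : ℝ) ^ (d + 1))⁻¹ : ℝ)) : 𝕜) • ∑ j : Fin (d + 1) → Fin L, ((Real.exp (ψ (site L M y j)) : ℝ) : 𝕜) • blockTransport T M U ω y j := by
  have hcast : ((L : 𝕜) ^ (d + 1))⁻¹ = (((((L : ℝ) ^ (d + 1))⁻¹ : ℝ)) : 𝕜) := by push_cast; ring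
  ext i
  rw [fib_apply, covQ_mulVec_apply, hcast, PiLp.smul_apply, smul_eq_mul, WithLp.ofLp_sum, Finset.sum_apply, Finset.mul_sum, Finset.mul_sum]
  refine Finset.sum_congr rfl fun j _ => ?_
  rw [PiLp.smul_apply, smul_eq_mul, blockTransport, Matrix.toLpLin_apply, PiLp.toLp_apply]
  congr 1
  unfold fib
  simp only [Matrix.mulVec, dotProduct, expWt, Finset.mul_sum]
  exact Finset.sum_congr rfl fun k _ => by ring

/-- ★★★ **THE BLOCK DEFECT**: for a unitary link field, every tree contour system, and a weight with `|φ(x) − φ(x′)| ≤ ϑ` whenever `x, x′` lie in one block: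
`Re⟨ω, Q(U)ᴴQ(U)ω⟩ − (cosh ϑ − 1)·L^{−(d+1)}·Σ_x‖ω_x‖² ≤ Re⟨ω, (Q(U)ᴴQ(U))_φ ω⟩` — per block, §2 on the transported fibres `U(Γ_j)ω_{x_j}` (norms `‖ω_{x_j}‖`) and Cauchy–Schwarz
`(Σ_j‖ω_{x_j}‖)² ≤ L^{d+1}Σ_j‖ω_{x_j}‖²`. [cite: Dimock2013, App. D, proof of Lemma 30 (city1); King1986, (2.13) p.653; Balaban1985BackgroundPropagators, (3.19) p.393, (3.24) p.394] -/
theorem re_conjForm_gram_sub_ge {U : Tor (fine L M) × Fin (d + 1) → Matrix n n 𝕜} (hU : ∀ bd, U bd ∈ Matrix.unitaryGroup n 𝕜) {φ : Tor (fine L M) → ℝ} {ϑ : ℝ}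
    (hϑ : ∀ x x', blockOf L M x = blockOf L M x' → |φ x - φ x'| ≤ ϑ) (ω : Tor (fine L M) × n → 𝕜) :
    RCLike.re (star ω ⬝ᵥ (((covQ T M U)ᴴ * covQ T M U) *ᵥ ω)) - (Real.cosh ϑ - 1) * ((L : ℝ) ^ (d + 1))⁻¹ * ∑ x, ‖fib (fine L M) ω x‖ ^ 2
      ≤ RCLike.re (star ω ⬝ᵥ (wtConj (fine L M) φ ((covQ T M U)ᴴ * covQ T M U) *ᵥ ω)) := by
  set Lr : ℝ := ((L : ℝ) ^ (d + 1))⁻¹ with hLr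
  have hL0 : (0 : ℝ) < (L : ℝ) ^ (d + 1) := by
    have : (0 : ℝ) < L := by exact_mod_cast Nat.pos_of_ne_zero (NeZero.ne L)
    positivity
  have hLr0 : 0 ≤ Lr := by rw [hLr]; positivity
  have hLrL : Lr * (L : ℝ) ^ (d + 1) = 1 := by rw [hLr, inv_mul_cancel₀ hL0.ne']
  have hcard : (Fintype.card (Fin (d + 1) → Fin L) : ℝ) = (L : ℝ) ^ (d + 1) := by
    rw [Fintype.card_fun, Fintype.card_fin, Fintype.card_fin]; push_cast; ring
  have hC0 : 0 ≤ Real.cosh ϑ - 1 := by linarith [Real.one_le_cosh ϑ]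
  rw [star_dotProduct_wtConj_mulVec, star_dotProduct_gram_mulVec, star_dotProduct_gram_mulVec, map_sum, map_sum]
  -- per block
  have hblock : ∀ y : Tor M, RCLike.re ⟪fib M (covQ T M U *ᵥ ω) y, fib M (covQ T M U *ᵥ ω) y⟫_𝕜 - (Real.cosh ϑ - 1) * Lr * ∑ j, ‖blockTransport T M U ω y j‖ ^ 2
      ≤ RCLike.re ⟪fib M (covQ T M U *ᵥ expWt (fine L M) φ ω) y, fib M (covQ T M U *ᵥ expWt (fine L M) (fun x => -φ x) ω) y⟫_𝕜 := by
    intro y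
    set β : (Fin (d + 1) → Fin L) → EuclideanSpace 𝕜 n := blockTransport T M U ω y with hβ
    set s : (Fin (d + 1) → Fin L) → ℝ := fun j => φ (site L M y j) with hs
    have hss : ∀ j j', |s j - s j'| ≤ ϑ := fun j j' => hϑ _ _ (by rw [blockOf_site, blockOf_site])
    have hA := re_inner_sum_expWt_ge (𝕜 := 𝕜) β s hss
    -- the three block means
    have h0 : fib M (covQ T M U *ᵥ ω) y = ((Lr : ℝ) : 𝕜) • ∑ j, β j := by
      have h := fib_covQ_mulVec_expWt T M U (fun _ => (0 : ℝ)) ω y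
      have hω : expWt (fine L M) (fun _ => (0 : ℝ)) ω = ω := by funext p; rw [expWt, Real.exp_zero, RCLike.ofReal_one, one_mul]
      rw [hω] at h
      rw [h]
      simp only [Real.exp_zero, RCLike.ofReal_one, one_smul, hβ, hLr]
    have hP : fib M (covQ T M U *ᵥ expWt (fine L M) φ ω) y = ((Lr : ℝ) : 𝕜) • ∑ j, ((Real.exp (s j) : ℝ) : 𝕜) • β j := fib_covQ_mulVec_expWt T M U φ ω y
    have hN : fib M (covQ T M U *ᵥ expWt (fine L M) (fun x => -φ x) ω) y = ((Lr : ℝ) : 𝕜) • ∑ j, ((Real.exp (-(s j)) : ℝ) : 𝕜) • β j :=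
      fib_covQ_mulVec_expWt T M U (fun x => -φ x) ω y
    have hUy : RCLike.re ⟪fib M (covQ T M U *ᵥ ω) y, fib M (covQ T M U *ᵥ ω) y⟫_𝕜 = Lr ^ 2 * ‖∑ j, β j‖ ^ 2 := by
      rw [h0, re_inner_smul_ofReal, ← @norm_sq_eq_re_inner 𝕜]
    have hPy : Lr ^ 2 * (‖∑ j, β j‖ ^ 2 - (Real.cosh ϑ - 1) * (∑ j, ‖β j‖) ^ 2)
        ≤ RCLike.re ⟪fib M (covQ T M U *ᵥ expWt (fine L M) φ ω) y, fib M (covQ T M U *ᵥ expWt (fine L M) (fun x => -φ x) ω) y⟫_𝕜 := by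
      rw [hP, hN, re_inner_smul_ofReal]; exact mul_le_mul_of_nonneg_left hA (sq_nonneg _)
    have hCS : (∑ j, ‖β j‖) ^ 2 ≤ (L : ℝ) ^ (d + 1) * ∑ j, ‖β j‖ ^ 2 := by
      have := sq_sum_le_card_mul_sum_sq (s := (Finset.univ : Finset (Fin (d + 1) → Fin L))) (f := fun j => ‖β j‖)
      rw [Finset.card_univ, hcard] at this
      exact this
    have hkey : Lr ^ 2 * ((Real.cosh ϑ - 1) * (∑ j, ‖β j‖) ^ 2) ≤ (Real.cosh ϑ - 1) * Lr * ∑ j, ‖β j‖ ^ 2 := by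
      calc Lr ^ 2 * ((Real.cosh ϑ - 1) * (∑ j, ‖β j‖) ^ 2) ≤ Lr ^ 2 * ((Real.cosh ϑ - 1) * ((L : ℝ) ^ (d + 1) * ∑ j, ‖β j‖ ^ 2)) :=
            mul_le_mul_of_nonneg_left (mul_le_mul_of_nonneg_left hCS hC0) (sq_nonneg _)
        _ = (Real.cosh ϑ - 1) * Lr * ∑ j, ‖β j‖ ^ 2 := by
            rw [show Lr ^ 2 * ((Real.cosh ϑ - 1) * ((L : ℝ) ^ (d + 1) * ∑ j, ‖β j‖ ^ 2)) = (Lr * (L : ℝ) ^ (d + 1)) * ((Real.cosh ϑ - 1) * Lr * ∑ j, ‖β j‖ ^ 2) by ring,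
              hLrL, one_mul]
    rw [hUy]
    linarith [hPy, hkey]
  rw [← sum_norm_blockTransport_sq T M hU ω, Finset.mul_sum, ← Finset.sum_sub_distrib]
  exact Finset.sum_le_sum fun y _ => hblock y

end Block

/-! ## §4 The conjugated full operator is coercive -/

section Full

variable {L : ℕ} [NeZero L] (T : BlockTree d L) (M : Fin (d + 1) → ℕ) [hM : ∀ μ, NeZero (M μ)]

omit [DecidableEq n] in
/-- `Re⟨ω, (rB)ω⟩ = r·Re⟨ω,Bω⟩` for a real scalar `r`. [folklore] -/
theorem re_star_dotProduct_ofReal_smul_mulVec (r : ℝ) (B : Matrix (Tor (fine L M) × n) (Tor (fine L M) × n) 𝕜) (ω : Tor (fine L M) × n → 𝕜) :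
    RCLike.re (star ω ⬝ᵥ ((((r : ℝ) : 𝕜) • B) *ᵥ ω)) = r * RCLike.re (star ω ⬝ᵥ (B *ᵥ ω)) := by
  rw [Matrix.smul_mulVec, dotProduct_smul, smul_eq_mul, RCLike.re_ofReal_mul]

/-- ★★★ **THE DEFECT OF THE FULL OPERATOR**: for unitary `U`, `a, c ≥ 0`, any `m²`, every tree contour system, and a weight `φ` with `|φ(x) − φ(x+e_μ)| ≤ δ` on bonds and
`|φ(x) − φ(x′)| ≤ ϑ` on blocks: `Re⟨ω, A₀(U)ω⟩ − (2(d+1)c(cosh δ − 1) + a(cosh ϑ − 1))·Σ_x‖ω_x‖² ≤ Re⟨ω, A₀(U)_φ ω⟩`.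
[cite: Dimock2013, App. D, proof of Lemma 30 (city1); King1986, (2.13) p.653, (4.5) p.670; Balaban1985BackgroundPropagators, (3.24) p.394] -/
theorem re_conjForm_fullOpU_sub_ge {a c : ℝ} (ha : 0 ≤ a) (hc : 0 ≤ c) (m2 : ℝ) {U : Tor (fine L M) × Fin (d + 1) → Matrix n n 𝕜} (hU : ∀ bd, U bd ∈ Matrix.unitaryGroup n 𝕜)
    {φ : Tor (fine L M) → ℝ} {δ ϑ : ℝ} (hφ : ∀ x μ, |φ x - φ (x + unitVec (fine L M) μ)| ≤ δ) (hϑ : ∀ x x', blockOf L M x = blockOf L M x' → |φ x - φ x'| ≤ ϑ)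
    (ω : Tor (fine L M) × n → 𝕜) :
    RCLike.re (star ω ⬝ᵥ (fullOpU T M a c m2 U *ᵥ ω)) - (2 * ((d : ℝ) + 1) * c * (Real.cosh δ - 1) + a * (Real.cosh ϑ - 1)) * ∑ x, ‖fib (fine L M) ω x‖ ^ 2
      ≤ RCLike.re (star ω ⬝ᵥ (wtConj (fine L M) φ (fullOpU T M a c m2 U) *ᵥ ω)) := by
  have hL0 : (0 : ℝ) < (L : ℝ) ^ (d + 1) := by
    have : (0 : ℝ) < L := by exact_mod_cast Nat.pos_of_ne_zero (NeZero.ne L)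
    positivity
  have h1 := re_conjForm_covLapF_sub_ge (fine L M) hc m2 hU hφ ω
  have h2 := re_conjForm_gram_sub_ge T M hU hϑ ω
  rw [fullOpU, wtConj_add, wtConj_smul, Matrix.add_mulVec, Matrix.add_mulVec, dotProduct_add, dotProduct_add, map_add, map_add,
    re_star_dotProduct_ofReal_smul_mulVec, re_star_dotProduct_ofReal_smul_mulVec]
  have h3 : a * (L : ℝ) ^ (d + 1) * ((Real.cosh ϑ - 1) * ((L : ℝ) ^ (d + 1))⁻¹ * ∑ x, ‖fib (fine L M) ω x‖ ^ 2) = a * (Real.cosh ϑ - 1) * ∑ x, ‖fib (fine L M) ω x‖ ^ 2 := by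
    field_simp
  have h4 : a * (L : ℝ) ^ (d + 1) * (RCLike.re (star ω ⬝ᵥ (((covQ T M U)ᴴ * covQ T M U) *ᵥ ω)) - (Real.cosh ϑ - 1) * ((L : ℝ) ^ (d + 1))⁻¹ * ∑ x, ‖fib (fine L M) ω x‖ ^ 2)
      ≤ a * (L : ℝ) ^ (d + 1) * RCLike.re (star ω ⬝ᵥ (wtConj (fine L M) φ ((covQ T M U)ᴴ * covQ T M U) *ᵥ ω)) :=
    mul_le_mul_of_nonneg_left h2 (by positivity)
  rw [mul_sub, h3] at h4
  linarith

/-- ★★★ **`κ`-COERCIVE `A₀(U)` ⟹ `(κ − ρ)`-COERCIVE CONJUGATED `A₀(U)`**: with `ρ = 2(d+1)c(cosh δ − 1) + a(cosh ϑ − 1)` (the source of `κ` is irrelevant: mass, block term in a tree gauge, small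
curvature, pure gauge…). [cite: Dimock2013, App. D, proof of Lemma 30 (city2); King1986, (4.5) p.670; Balaban1985BackgroundPropagators, (3.24) p.394] -/
theorem re_conjForm_fullOpU_ge {a c : ℝ} (ha : 0 ≤ a) (hc : 0 ≤ c) (m2 : ℝ) {U : Tor (fine L M) × Fin (d + 1) → Matrix n n 𝕜} (hU : ∀ bd, U bd ∈ Matrix.unitaryGroup n 𝕜)
    {κ : ℝ} (hcoer : ∀ v : Tor (fine L M) × n → 𝕜, κ * ∑ x, ‖fib (fine L M) v x‖ ^ 2 ≤ RCLike.re (star v ⬝ᵥ (fullOpU T M a c m2 U *ᵥ v)))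
    {φ : Tor (fine L M) → ℝ} {δ ϑ : ℝ} (hφ : ∀ x μ, |φ x - φ (x + unitVec (fine L M) μ)| ≤ δ) (hϑ : ∀ x x', blockOf L M x = blockOf L M x' → |φ x - φ x'| ≤ ϑ)
    (ω : Tor (fine L M) × n → 𝕜) :
    (κ - 2 * ((d : ℝ) + 1) * c * (Real.cosh δ - 1) - a * (Real.cosh ϑ - 1)) * ∑ x, ‖fib (fine L M) ω x‖ ^ 2
      ≤ RCLike.re (star ω ⬝ᵥ (wtConj (fine L M) φ (fullOpU T M a c m2 U) *ᵥ ω)) := by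
  have h1 := re_conjForm_fullOpU_sub_ge T M ha hc m2 hU hφ hϑ ω
  have h2 := hcoer ω
  nlinarith [h1, h2, Finset.sum_nonneg fun x (_ : x ∈ Finset.univ) => sq_nonneg ‖fib (fine L M) ω x‖]

/-- ★★★ **WITH THE TREE's COMBES–THOMAS WEIGHT** `ctW L M κ_w x₀ = (κ_w∕L)·tdist(·,x₀)` (Dimock's `e_q`, `1`-Lipschitz in the physical distance `tdist∕L`; `κ_w ≥ 0`): bond oscillation `κ_w∕L`,
block oscillation `κ_w`, hence `(κ − 2(d+1)c(cosh(κ_w∕L) − 1) − a(cosh κ_w − 1))·Σ_x‖ω_x‖² ≤ Re⟨ω, A₀(U)_{ctW} ω⟩` for every centre `x₀`.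
[cite: Dimock2013, App. D, proof of Lemma 30; King1986, (4.33) p.674] -/
theorem re_conjForm_fullOpU_ctW_ge {a c : ℝ} (ha : 0 ≤ a) (hc : 0 ≤ c) (m2 : ℝ) {U : Tor (fine L M) × Fin (d + 1) → Matrix n n 𝕜} (hU : ∀ bd, U bd ∈ Matrix.unitaryGroup n 𝕜)
    {κ : ℝ} (hcoer : ∀ v : Tor (fine L M) × n → 𝕜, κ * ∑ x, ‖fib (fine L M) v x‖ ^ 2 ≤ RCLike.re (star v ⬝ᵥ (fullOpU T M a c m2 U *ᵥ v)))
    {κw : ℝ} (hκw : 0 ≤ κw) (x₀ : Tor (fine L M)) (ω : Tor (fine L M) × n → 𝕜) :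
    (κ - 2 * ((d : ℝ) + 1) * c * (Real.cosh (κw / L) - 1) - a * (Real.cosh κw - 1)) * ∑ x, ‖fib (fine L M) ω x‖ ^ 2
      ≤ RCLike.re (star ω ⬝ᵥ (wtConj (fine L M) (ctW L M κw x₀) (fullOpU T M a c m2 U) *ᵥ ω)) :=
  re_conjForm_fullOpU_ge T M ha hc m2 hU hcoer (fun x μ => (abs_ctW_bond_le L M hκw x₀ x μ).1) (fun x x' h => abs_ctW_block_le L M hκw x₀ x x' h) ω

end Full

end Summit.QuantumFields.YangMills.BalabanUVNodes.N15KingModelRung.CombesThomas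

end
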